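import Literature.NumberTheory.EllipticCurves.Rank1Residual.Typed.KolyvaginCertificate
import Literature.NumberTheory.EllipticCurves.Rank1Residual.Typed.X9
import Literature.NumberTheory.EllipticCurves.Cha2005.ShaIndexBoundIrreducible
import HarnessLib

/-!
# Class X9: the Heegner-index certificate at a NON-surjective irreducible prime (Cha 2005) ⇒ `BSD(E,p)` per curve (cell `b2b-bsdres`)

HONEST FRAMING (run/shared/lean/b2b/bsd-rank1-residual/, verbatim): the goal of the cell is to
DELETE the COMBINATION-SHAPED residual classes for ALL analytic-rank `≤ 1` elliptic curves over `ℚ`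
— "full BSD formula for every rank `≤ 1` curve in class C" assembled STRICTLY from published
theorems — so that the rank-`≤ 1` remainder becomes exactly the CONSTRUCTION-SHAPED classes, which
are TYPED (missing-input Props), NOT attempted; this is not "finishing BSD". X9's label
(typed; (im) unsatisfiable, `ClassX9.not_bigIm`) is NOT changed by anything here: this file is the
PER-CURVE certificate shape, not a class theorem.

**What this file adds (X9 prover gen 6, unit `b2b-bsdres-x9-g6`).** The tree's Kolyvagin
certificate `Typed.bsdp_of_kolyvagin_of_not_dvd_index` (`KolyvaginCertificate.lean`) needs
`ρ̄_{E,p}` SURJECTIVE — false on X9 by definition (`ClassX9 W p` has `¬ Surj W p`). Cha 2005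
(Miller 2011 Thm. 5.2 / GJPST 2009 Thm. 3.5; named fact
`Cha2005.thm52_padicValNat_shaOrder_le`, PUBLISHED, flag `Cha05-primary-unread`) replaces
surjectivity by IRREDUCIBILITY at the price of `p ∤ d_K` and `p² ∤ N`; on X9 both Galois
hypotheses (`¬cm`, `irr`, `p` odd) come from the class predicate and `p² ∤ N` from `p` good. So:

* `noPTorsion_of_cha_of_not_dvd_index`, `bsdp_of_cha_of_not_dvd_index` — general per-curve
  form: non-CM `E`, odd `p`, `E[p]` irreducible, `r_an ≤ 1`, a Heegner field `K` with `p ∤ d_K`,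
  `p² ∤ N`, a Heegner point `y_K` of infinite order with `p ∤ [E(K) : ℤ y_K]`, and `p ∤ #Ш_an`
  ⇒ `Ш(E/ℚ)[p] = 0` and `BSD(E,p)`;
* `X9.bsdp_of_cha_of_not_dvd_index`, `X9.missingInputAt_of_cha_of_not_dvd_index` — the X9
  instances (every X9 pair with `p ∤ #Ш_an` is a Cha-certificate CANDIDATE; the certificate is
  the triple (`K`, `y_K` non-torsion, `p ∤ I_K`), a finite computation — Gross–Zagier index, cell
  job lines `R0/R1` of `HOME/b2b-bsdres-x9/g6/`);
* `X10b.bsdp_of_cha_of_not_dvd_index` — the same at `p = 3` for X9's shadow X10b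
  (`ClassX10 W 3 ∧ ¬ Surj W 3`; `3` good so `9 ∤ N`).

Census use (RESIDUAL-CASES §a.2 X9, N < 2·10⁴, all at `p = 5`): the lane's open pairs
`7688j1, 7688k1` (r = 1; only fields with `5 ∣ d_K` had a certified index) and
`2268b1, 8092a1, 11552j1, 12996c1, 12996d1, 17298b1, 19044i1` (r = 0; no generator of the twist
found below the lane's cap) are exactly of this shape; the partners `11552i1, 17298a1, 6897b1` were
closed by the lane through this theorem (T-CHA). Numbers are the lane's to certify (two engines).
Binders: `hCha` (this fact), `hGZK` (bsd.S17); nothing announced. Not a class theorem.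
-/

noncomputable section

open scoped Classical

open WeierstrassCurve Literature.NumberTheory.EllipticCurves
  Literature.NumberTheory.EllipticCurves.Rank1Residual
  Literature.NumberTheory.EllipticCurves.Cha2005

namespace Literature.NumberTheory.EllipticCurves.Rank1Residual.Typed

variable (W : WeierstrassCurve ℚ) [W.IsElliptic] [W.IsGloballyMinimal] (p : ℕ) [Fact p.Prime]

/-- **Cha's index certificate gives `Ш(E/ℚ)[p] = 0`.** For a non-CM `E/ℚ` of analytic rank
`≤ 1`, an imaginary quadratic `K` with the Heegner hypothesis for the level `N`, a Heegner point
`P = y_K` of infinite order, and an odd prime `p` with `p ∤ d_K`, `p² ∤ N`, `ρ̄_{E,p}` irreducible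
and `p ∤ [E(K) : ℤ P]`: Cha's bound (`hCha`) gives `ord_p #Ш(E/ℚ) = 0`, `Ш(E/ℚ)` is finite by
Gross–Zagier–Kolyvagin (`hGZK`), hence no nonzero class is killed by `p`.
[cite: Miller2011LMS, Thm. 5.2 (arXiv:1010.2431 p. 11)] -/
theorem noPTorsion_of_cha_of_not_dvd_index (hCha : thm52_padicValNat_shaOrder_le)
    (hGZK : rank_eq_analyticRank_of_analyticRank_le_one)
    {N : ℕ} [NeZero N] {K : Type} [Field K] [NumberField K] (hK : IsImaginaryQuadratic K)
    (hH : SatisfiesHeegnerHypothesis N K) {P : (W.baseChange K).toAffine.Point}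
    (hP : IsHeegnerPoint N W K P) (hnt : ¬ IsOfFinAddOrder P)
    (hcm : ¬ W.HasCM) (hp2 : p ≠ 2) (hpD : ¬ (p : ℤ) ∣ NumberField.discr K) (hpN : ¬ p ^ 2 ∣ N)
    (hirr : Irr W p) (hr : W.analyticRank ≤ 1) (hI : ¬ p ∣ (AddSubgroup.zmultiples P).index) :
    ∀ x : W.sha, (p : ℤ) • x = 0 → x = 0 :=
  noPTorsion_of_padicValNat_shaOrder_eq_zero W p (hGZK W hr).2
    (padicValNat_shaOrder_eq_zero_of_not_dvd_index hCha W hK hH hP hnt p hcm hp2 hpD hpN hirr hr hI)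

/-- **`BSD(E,p)` from Cha's index certificate at a pair with `p ∤ #Ш_an`** (analytic rank `≤ 1`;
PUBLISHED named fact `hCha` + GZK `hGZK`; the certificate is the Heegner field `K` (`p ∤ d_K`), the
Heegner point `P` of infinite order and `p ∤ [E(K) : ℤ P]`, with `p` odd, `p² ∤ N`, `E` non-CM and
`ρ̄_{E,p}` irreducible — NOT necessarily surjective). Per curve; not a class theorem.
[cite: Miller2011LMS, Thm. 5.2 and Def. 1.1] -/
theorem bsdp_of_cha_of_not_dvd_index (hCha : thm52_padicValNat_shaOrder_le)
    (hGZK : rank_eq_analyticRank_of_analyticRank_le_one)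
    {N : ℕ} [NeZero N] {K : Type} [Field K] [NumberField K] (hK : IsImaginaryQuadratic K)
    (hH : SatisfiesHeegnerHypothesis N K) {P : (W.baseChange K).toAffine.Point}
    (hP : IsHeegnerPoint N W K P) (hnt : ¬ IsOfFinAddOrder P)
    (hcm : ¬ W.HasCM) (hp2 : p ≠ 2) (hpD : ¬ (p : ℤ) ∣ NumberField.discr K) (hpN : ¬ p ^ 2 ∣ N)
    (hirr : Irr W p) (hI : ¬ p ∣ (AddSubgroup.zmultiples P).index)
    (hr : W.analyticRank ≤ 1) {q : ℚ} (hq : shaAn W = (q : ℂ)) (hv : padicValRat p q = 0) :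
    BSDp W p :=
  bsdp_of_shaAn_unit_of_noPTorsion W p hGZK hr hq hv
    (noPTorsion_of_cha_of_not_dvd_index W p hCha hGZK hK hH hP hnt hcm hp2 hpD hpN hirr hr hI)

/-! ### Class X9 -/

/-- **X9, either rank, `p ∤ #Ш_an`: `BSD(E,p)` from PUBLISHED theorems plus the Cha index
certificate.** On `ClassX9 W p` the Galois hypotheses of Cha's bound are AUTOMATIC: `E` is non-CM,
`E[p]` is irreducible and `p ≥ 5` is odd (all fields of the class predicate); `p² ∤ N` is the
binder `hpN` (on X9 `p` is a good prime, so `p ∤ N_E`; kept as a binder because the level `N` of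
the Heegner datum is an independent variable of the statement). The surjective Kolyvagin
certificate `bsdp_of_kolyvagin_of_not_dvd_index` is unusable here (`¬ Surj W p`). What remains
per pair is the finite certificate (`K` with `p ∤ d_K`, `y_K` non-torsion, `p ∤ [E(K) : ℤ y_K]`).
NOT a class theorem; X9's label is unchanged. [cite: Miller2011LMS, Thm. 5.2 and Def. 1.1]
[cite: GrigorovJorzaPatrikisSteinTarnita2009, Thm. 3.5 and Rem. 3.6 (608b at p = 5)] -/
theorem X9.bsdp_of_cha_of_not_dvd_index (hCha : thm52_padicValNat_shaOrder_le)
    (hGZK : rank_eq_analyticRank_of_analyticRank_le_one) (hX : ClassX9 W p)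
    {N : ℕ} [NeZero N] {K : Type} [Field K] [NumberField K] (hK : IsImaginaryQuadratic K)
    (hH : SatisfiesHeegnerHypothesis N K) {P : (W.baseChange K).toAffine.Point}
    (hP : IsHeegnerPoint N W K P) (hnt : ¬ IsOfFinAddOrder P)
    (hpD : ¬ (p : ℤ) ∣ NumberField.discr K) (hpN : ¬ p ^ 2 ∣ N)
    (hI : ¬ p ∣ (AddSubgroup.zmultiples P).index)
    (hr : W.analyticRank ≤ 1) {q : ℚ} (hq : shaAn W = (q : ℂ)) (hv : padicValRat p q = 0) :
    BSDp W p := by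
  obtain ⟨hcm, -, hp5, hirr, -, -⟩ := hX
  have hp2 : p ≠ 2 := by omega
  exact Typed.bsdp_of_cha_of_not_dvd_index W p hCha hGZK hK hH hP hnt hcm hp2 hpD hpN hirr hI hr hq hv

/-- **X9: the typed missing input of `Typed/X9.lean` is DISCHARGED, pair by pair, by the Cha
certificate** (for `p ∤ #Ш_an`): `X9.MissingInputAt W p` (= `MissingPPartAt W p`) holds at every
X9 pair carrying the certificate. Bookkeeping only; the class stays typed. [cite: Miller2011LMS, Thm. 5.2 and Def. 1.1] -/
theorem X9.missingInputAt_of_cha_of_not_dvd_index (hCha : thm52_padicValNat_shaOrder_le)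
    (hGZK : rank_eq_analyticRank_of_analyticRank_le_one) (hX : ClassX9 W p)
    {N : ℕ} [NeZero N] {K : Type} [Field K] [NumberField K] (hK : IsImaginaryQuadratic K)
    (hH : SatisfiesHeegnerHypothesis N K) {P : (W.baseChange K).toAffine.Point}
    (hP : IsHeegnerPoint N W K P) (hnt : ¬ IsOfFinAddOrder P)
    (hpD : ¬ (p : ℤ) ∣ NumberField.discr K) (hpN : ¬ p ^ 2 ∣ N)
    (hI : ¬ p ∣ (AddSubgroup.zmultiples P).index)
    (hr : W.analyticRank ≤ 1) {q : ℚ} (hq : shaAn W = (q : ℂ)) (hv : padicValRat p q = 0) :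
    X9.MissingInputAt W p := by
  obtain ⟨hcm, -, hp5, hirr, -, -⟩ := hX
  have hp2 : p ≠ 2 := by omega
  exact missingPPartAt_of_shaAn_unit_of_noPTorsion W p (hGZK W hr).2 hq hv
    (noPTorsion_of_cha_of_not_dvd_index W p hCha hGZK hK hH hP hnt hcm hp2 hpD hpN hirr hr hI)

/-! ### Class X10b (`p = 3`) -/

/-- **X10b (`ClassX10 W 3 ∧ ¬ Surj W 3`, X9's shadow at `p = 3`), either rank, `3 ∤ #Ш_an`:
`BSD(E,3)` from the Cha index certificate.** `ClassX10` supplies `E[3]` irreducible and `3` good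
ordinary; Cha's bound allows `p = 3` (`p ∤ 2·Δ(K)`); non-CM is the binder `hcm` (a CM curve has no
good ordinary… — not used: kept explicit), `9 ∤ N` the binder `hpN`. Per curve; not a class
theorem; X10b keeps X9's label. [cite: Miller2011LMS, Thm. 5.2 and Def. 1.1] -/
theorem X10b.bsdp_of_cha_of_not_dvd_index (hCha : thm52_padicValNat_shaOrder_le)
    (hGZK : rank_eq_analyticRank_of_analyticRank_le_one) [Fact (3 : ℕ).Prime]
    (hX : ClassX10 W 3) (hcm : ¬ W.HasCM)
    {N : ℕ} [NeZero N] {K : Type} [Field K] [NumberField K] (hK : IsImaginaryQuadratic K)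
    (hH : SatisfiesHeegnerHypothesis N K) {P : (W.baseChange K).toAffine.Point}
    (hP : IsHeegnerPoint N W K P) (hnt : ¬ IsOfFinAddOrder P)
    (hpD : ¬ (3 : ℤ) ∣ NumberField.discr K) (hpN : ¬ 3 ^ 2 ∣ N)
    (hI : ¬ 3 ∣ (AddSubgroup.zmultiples P).index)
    (hr : W.analyticRank ≤ 1) {q : ℚ} (hq : shaAn W = (q : ℂ)) (hv : padicValRat 3 q = 0) :
    BSDp W 3 := by
  obtain ⟨-, -, hirr, -⟩ := hX
  exact Typed.bsdp_of_cha_of_not_dvd_index W 3 hCha hGZK hK hH hP hnt hcm (by decide) hpD hpN hirr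
    hI hr hq hv

end Literature.NumberTheory.EllipticCurves.Rank1Residual.Typed

end
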